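import Summits.QuantumAdvantage.QuantumAdvantage.Theorems.IqThreeNotPPoly.Negative.RefutationShape
import Literature.Computability.Complexity.StringCopy
import Literature.Computability.Complexity.BrickAlgebra
import Literature.Computability.Complexity.ReductionsProofs

/-!
# Negative-side lemma for the crux `ArithStatLadder.IqThreeNotBPP` (stmt-QuantumAdvantage-14864): the prime core, uniformly

From the standing disprover's work file `Cruxes/IqThreeNotBPP/Disproof.lean` (§4, load-bearing
analysis), cdisprove seat, 2026-08-16. Nothing here asserts a Theses decl positively. This is the
UNIFORM twin of `IqThreeNotPPoly.Negative.primeIqThreeLang_mem_PPoly_of_not`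
(`Theorems/IqThreeNotPPoly/Negative/RefutationShape.lean`, whose set identities are reused).

The crux is `IQ3 ∉ BPP`, `IQ3 = bin S`, `S = {d : ℕ | −d fundamental ∧ 3 ∣ h(−d)}`. Of the
conjuncts of `S`, the class-number conjunct ALONE is load-bearing for hardness: intersecting with
the `P`-language `PRIMES` (AKS; tree theorem `PRIMES_mem_P'`) removes every trace of squarefreeness
and of genus structure (prime discriminants `−p`, `p ≡ 3 (mod 4)`: one genus, no Rédei data), and
`BPP` is closed under intersection with `P`:

* `inter_mem_BPP_of_mem_P` — `L ∈ BPP → K ∈ P → L ⊓ K ∈ BPP` (elementary; witness `L' ⊓ fst⁻¹K`,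
  same coin polynomial);
* `primeIqThreeLang_mem_BPP_of_not` — **a refutation of the crux decides `3 ∣ h(−p)` on primes in
  `BPP`**: `¬IqThreeNotBPP → bin {p prime : p ≡ 3 (4), 3 ∣ h(−p)} ∈ BPP`. Read contrapositively:
  hardness of the factoring-free prime core suffices for the crux (ideator memo M6,
  `Cruxes/IqThreeNotBPP/BarrierNotes-r1-k1.md`).
-/

namespace Summit.QuantumAdvantage.QuantumAdvantage.Theorems.IqThreeNotBPP.Negative

open _root_.Computability
open Literature.Computability.Complexity
open Literature.Computability.Complexity.Brick (fstF fstF_boolPair fstF_mem_FP)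
open Literature.Computability.Cryptography (IsNegFundamentalDiscr)
open Literature.Computability.QuantumComplexity (PRIMES PRIMES_mem_P')
open Literature.NumberTheory.QuadraticFields (BinaryQuadraticForm.classNumber)
open Summit.QuantumAdvantage.QuantumAdvantage.Theses.ArithStatLadder (IqThreeNotBPP)
open Summit.QuantumAdvantage.QuantumAdvantage.Theorems.IqThreeNotPPoly.Negative (primeIqThreeLang_eq)

/-- The crux is literally `bin S ∉ BPP`. [folklore] -/
theorem iqThreeNotBPP_iff : IqThreeNotBPP ↔ (encodingNatBool.toLanguage {d : ℕ | IsNegFundamentalDiscr d ∧ 3 ∣ BinaryQuadraticForm.classNumber (-(d : ℤ))}) ∉ BPP :=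
  Iff.rfl

/-- **`BPP` is closed under intersection with a `P` language**: for `L ∈ BPP` with witness
`L' ∈ P` and `K ∈ P`, the witness `L' ⊓ fst⁻¹ K ∈ P` works with the same coin polynomial — on
`x ∈ K` the event is unchanged, on `x ∉ K` every coin string is correct.
[cite: AroraBarakCC2009, §7.1] -/
theorem inter_mem_BPP_of_mem_P {L K : Language Bool} (hL : L ∈ BPP) (hK : K ∈ Classes.P) :
    L ⊓ K ∈ BPP := by
  obtain ⟨L', hL', p, hp⟩ := hL
  refine ⟨L' ⊓ (fstF ⁻¹' K), inter_mem_P hL' (preimage_mem_P hK fstF_mem_FP), p, fun x => ?_⟩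
  have hmem : ∀ z : List Bool, z ∈ L' ⊓ (fstF ⁻¹' K) ↔ z ∈ L' ∧ fstF z ∈ K := fun z => Iff.rfl
  have hmem' : ∀ z : List Bool, z ∈ L ⊓ K ↔ z ∈ L ∧ z ∈ K := fun z => Iff.rfl
  by_cases hx : x ∈ K
  · have hset : {y : List Bool | boolPair x y ∈ L' ⊓ (fstF ⁻¹' K) ↔ x ∈ L ⊓ K} =
        {y : List Bool | boolPair x y ∈ L' ↔ x ∈ L} := by
      ext y
      simp only [Set.mem_setOf_eq, hmem, hmem', fstF_boolPair, hx, and_true]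
    rw [hset]
    exact hp x
  · have hset : {y : List Bool | boolPair x y ∈ L' ⊓ (fstF ⁻¹' K) ↔ x ∈ L ⊓ K} = Set.univ := by
      ext y
      simp only [Set.mem_setOf_eq, hmem, hmem', fstF_boolPair, hx, and_false, Set.mem_univ]
    rw [hset, uniformProb_univ]
    norm_num

/-- **A refutation of the crux decides `3 ∣ h(−p)` on primes in `BPP`**:
`¬IqThreeNotBPP → bin {p prime : p ≡ 3 (mod 4), 3 ∣ h(−p)} ∈ BPP` (`IQ3 ⊓ PRIMES`, with
`PRIMES ∈ P` by AKS, `PRIMES_mem_P'`). No squarefreeness, one genus, no Rédei data: the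
class-number conjunct of the crux is load-bearing on its own. [cite: AgrawalKayalSaxena2004, §1] -/
theorem primeIqThreeLang_mem_BPP_of_not (h : ¬ IqThreeNotBPP) :
    encodingNatBool.toLanguage {p : ℕ | p.Prime ∧ p % 4 = 3 ∧ 3 ∣ BinaryQuadraticForm.classNumber (-(p : ℤ))} ∈ BPP := by
  rw [primeIqThreeLang_eq]
  rw [iqThreeNotBPP_iff, not_not] at h
  exact inter_mem_BPP_of_mem_P h PRIMES_mem_P'

end Summit.QuantumAdvantage.QuantumAdvantage.Theorems.IqThreeNotBPP.Negative
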